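import Summits.QuantumFields.YangMills.Theorems.BalabanUVNodesN19AdditiveLinksFirstOrder
import Summits.QuantumFields.YangMills.Theorems.BalabanUVNodesN19LipschitzLinksDegreeBudgetLogSq

/-!
# YM-DAG node N19 (= NE7 proper) — EVERY LIPSCHITZ LINK OF EVERY ADDITIVE LIPSCHITZ STATISTIC `Σ_iφ_i(x_i)` AT THE RIDGE RATE UP TO `log²`
# (`dist_∞(h(Σ_iφ_i(x_i)), Π_t) ≤ 2·10⁵·K·d·log₂²t∕t` for `1`-Lipschitz `φ_i : [−1,1] → [0,1]` and `K`-Lipschitz `h` — module 160 with the Jackson kernel)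

Cell `pub-ymgap`, HUMAN RULING D-0062 (Track A) ∕ D-0149 (work-bound push), R141 (C) wider-strategy seat `pub-ymgap-dag-n19-e` (strategy
s3 = ALTERNATIVE CURRENCY), generation g33, module 24 (lineage module 171).  Route `Summits/QuantumFields/YangMills/Theses/BalabanUVNodes.lean`,
cluster item K3⁸ «SpineGivenEndpointR13SepCoPHV» (stmt-QuantumFields-27366); filed `--supports` that item `--as helper` (it proves no registered
stub).  COUNT-NEUTRAL: [folklore]∕[bookkeeping] over the lineage BY NAME — module 159 `…N19AdditiveLinksFirstOrder`
(`exists_mvPolynomial_near_trigLink_additive_firstOrder`), module 158 (`additive_mem_Icc`), module 167 `…N19LipschitzLinkJacksonSmoothing`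
(`exists_trigLink_near_lipschitzLink_jackson`), module 168 `…N19LipschitzLinksDegreeBudgetLogSq` (`logb_sq_le25`, `exists_parameters_logSq`,
`errorBound_logSq`); no laws, no scheme object, no Theses import; NOT a discharge claim.

THE RESULT.  Module 160 priced every `K`-Lipschitz link of an additive Lipschitz statistic `Σ_iφ_i(x_i)` (`φ_i : [−1,1] → [0,1]` `1`-Lipschitz) at
`10⁴·K·d·log₂³t∕t` in the degree model; one logarithm was the Fejér kernel's.  THIS MODULE replaces module 152a's smoothing by module 167's LOG-FREE
Jackson–Steklov smoothing and module 152b's bookkeeping by module 168's: ★★★ `exists_mvPolynomial_near_lipschitzLink_additive_logSq` — **for every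
`t ≥ 2`, `P` of total degree `≤ t` with `|h(Σ_iφ_i(x_i)) − P(x)| ≤ 2·10⁵·K·d·(log₂t)²∕t` on `[−1,1]^ι`**; ★★★ `…_general_logSq` — `K_φ`-Lipschitz
`G_φ`-bounded `φ_i` (`K_φ, G_φ ≤ c`), `h` `K`-Lipschitz on `[−dc, dc]`: `≤ 2·10⁵·(2cK)·d·(log₂t)²∕t`.  READING (CURRENCY-MAP v7's composition class):
`sup_{h 1-Lip} dist_∞(h(Σ_iφ_i), Π_t) ≲ c·d·log²t∕t` — the ridge rate up to `log²`.

HONEST FRAMING (binding).  Elementary and [folklore]; ONE-SIDED (upper bound; for `φ = |·|` module 134 gives `d∕(π(9t+6))`); NO consumer in the DAG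
today (the seat's own currency map, degree model); nothing of Bałaban's instantiated; NE7 NOT PRINTED, NOT proved; N19 NOT discharged; count-neutral.
One finite `T⁴` programme at fixed `ε`; nothing continuum ∕ `ℝ⁴` ∕ OS ∕ mass-gap ∕ Clay.  0 `def` ∕ 0 `sorry`.
-/

noncomputable section

open Finset
open scoped Real

namespace Summit.QuantumFields.YangMills.Theorems.BalabanUVNodesN19AdditiveLinksDegreeBudgetLogSq

open Summit.QuantumFields.YangMills.Theorems.BalabanUVNodesN19AdditiveLinksFirstOrder (exists_mvPolynomial_near_trigLink_additive_firstOrder)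
open Summit.QuantumFields.YangMills.Theorems.BalabanUVNodesN19AdditiveLinksLadder (additive_mem_Icc)
open Summit.QuantumFields.YangMills.Theorems.BalabanUVNodesN19LipschitzLinkJacksonSmoothing (exists_trigLink_near_lipschitzLink_jackson)
open Summit.QuantumFields.YangMills.Theorems.BalabanUVNodesN19LipschitzLinksDegreeBudgetLogSq (logb_sq_le25 exists_parameters_logSq errorBound_logSq)

variable {ι : Type*} [Fintype ι] [Nonempty ι]
variable {φ : ι → ℝ → ℝ}
  (hφL : ∀ i, ∀ u v : ℝ, u ∈ Set.Icc (-1 : ℝ) 1 → v ∈ Set.Icc (-1 : ℝ) 1 → |φ i u - φ i v| ≤ 1 * |u - v|)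
  (hφ0 : ∀ i, ∀ u : ℝ, u ∈ Set.Icc (-1 : ℝ) 1 → 0 ≤ φ i u) (hφ1 : ∀ i, ∀ u : ℝ, u ∈ Set.Icc (-1 : ℝ) 1 → φ i u ≤ 1)
include hφL hφ0 hφ1

/-! ## §1 ★★★ Every Lipschitz link of `Σ_iφ_i(x_i)` at the ridge rate up to `log³` [folklore] -/

/-- ★★★ **EVERY LIPSCHITZ LINK OF EVERY ADDITIVE LIPSCHITZ STATISTIC AT THE RIDGE RATE UP TO `log²` (budget `t ≥ 2^25`).**  Let
`φ_i : ℝ → ℝ` be `1`-Lipschitz with values in `[0,1]` on `[−1,1]`.  For finite nonempty `ι` (`d = |ι|`), `K ≥ 0`, `h : ℝ → ℝ` with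
`|h(s) − h(s′)| ≤ K|s − s′|` on `[0, d]` and `t ≥ 2^25` there is `P : MvPolynomial ι ℝ` of total degree `≤ t` with
`|h(Σ_iφ_i(x_i)) − P(x)| ≤ 196000·K·d·(log₂t)²∕t` on `[−1,1]^ι` (module 168's parameters and bookkeeping, module 167's log-free smoothing, module 159's
additive first-order law). [folklore] -/
theorem exists_mvPolynomial_near_lipschitzLink_additive_logSq_of_le {h : ℝ → ℝ} {K : ℝ} (hK0 : 0 ≤ K)
    (hK : ∀ s s', s ∈ Set.Icc (0 : ℝ) (Fintype.card ι) → s' ∈ Set.Icc (0 : ℝ) (Fintype.card ι) → |h s - h s'| ≤ K * |s - s'|)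
    {t : ℕ} (ht : 2 ^ 25 ≤ t) :
    ∃ P : MvPolynomial ι ℝ, P.totalDegree ≤ t ∧
      ∀ x : ι → ℝ, (∀ i, x i ∈ Set.Icc (-1 : ℝ) 1) →
        |h (∑ i, φ i (x i)) - MvPolynomial.eval x P| ≤ 196000 * K * Fintype.card ι * Real.logb 2 t ^ 2 / t := by
  set d : ℝ := (Fintype.card ι : ℝ) with hdd
  have hd : 0 < d := by rw [hdd]; exact_mod_cast Fintype.card_pos
  have ht0 : (0 : ℝ) < t := by exact_mod_cast (show 0 < t by omega)
  have htr : (16777216 : ℝ) ≤ t := le_trans (by norm_num) (by exact_mod_cast ht : ((2 ^ 25 : ℕ) : ℝ) ≤ t)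
  obtain ⟨hΛ25, hΛsq⟩ := logb_sq_le25 ht
  have hΛ24 : 24 ≤ Real.logb 2 t := by linarith
  obtain ⟨L, J, hh, N, hL1, htL, hLt, hh1, hJh, hexph, hJ1, hLππ, hNJ, hJsq, hN4, hdeg⟩ := exists_parameters_logSq ht
  have hLr : (1 : ℝ) ≤ L := by exact_mod_cast hL1
  obtain ⟨α, β, ω, g, g₁, hω0, hωΩ, hW, hg, hg₁, hC11, hB1, herr⟩ := exists_trigLink_near_lipschitzLink_jackson hd hK0 hK hL1
  have hΩ : (0 : ℝ) ≤ 2 * L * π / d := by positivity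
  obtain ⟨P, hPdeg, hPerr⟩ := exists_mvPolynomial_near_trigLink_additive_firstOrder hφL hφ0 hφ1
    (((range L ×ˢ range L) ×ˢ (range L ×ˢ range L)) ×ˢ (Finset.univ : Finset Bool)) (h 0) α β ω
    (Ω := 2 * L * π / d) (W := π ^ 4 * (K * d) * L / 8) (B₁ := K) (B₂ := K * π * L / d) hg hg₁ hΩ hω0 hωΩ hW hC11 hB1 J hh N hh1 hJh hNJ
  refine ⟨P, ?_, fun x hx => ?_⟩
  · have e : 2 * Real.exp 2 * (2 * L * π / d) * (Fintype.card ι : ℝ) * (1 / 2 + π + 3 * π * J) =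
        2 * Real.exp 2 * (2 * L * π) * (1 / 2 + π + 3 * π * J) := by rw [← hdd]; field_simp
    rw [e] at hPdeg
    exact Nat.cast_le.1 (hPdeg.trans hdeg)
  · have hS := additive_mem_Icc hφ0 hφ1 x hx
    rw [← hdd] at hS hPerr
    have h1 := herr (∑ i, φ i (x i)) ⟨hS.1, hS.2⟩
    have h2 := hPerr x hx
    -- the arithmetic
    have hLt' : (L : ℝ) ≤ t := by
      have h1 : (1 : ℝ) ≤ 13824 * Real.logb 2 t ^ 2 := by nlinarith only [hΛ24]
      exact (le_mul_of_one_le_left (by positivity) h1).trans hLt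
    have hε : 2 * ((J : ℝ) + 1) * Real.exp (-(hh : ℝ)) ≤ 1 / (2 * t ^ 2) := by
      calc 2 * ((J : ℝ) + 1) * Real.exp (-(hh : ℝ)) ≤ 2 * (t / 4) * (1 / t ^ 3) := by
            have := mul_le_mul hJ1 hexph (Real.exp_pos _).le (by positivity)
            linarith only [this]
        _ = 1 / (2 * t ^ 2) := by field_simp; ring
    have hNJr : ((2 : ℝ) ^ J) ≤ N := by exact_mod_cast hNJ
    have key := errorBound_logSq (M := (2 : ℝ) ^ J) (ε := 2 * ((J : ℝ) + 1) * Real.exp (-(hh : ℝ))) hK0 hd htr hΛ24 hLr hLt' htL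
      hLππ hNJr hJsq hN4 hε
    calc |h (∑ i, φ i (x i)) - MvPolynomial.eval x P|
        ≤ |h (∑ i, φ i (x i)) - g (∑ i, φ i (x i))| + |g (∑ i, φ i (x i)) - MvPolynomial.eval x P| := abs_sub_le _ _ _
      _ ≤ K * d * (1 / π + 3 * π ^ 4 / 32) / L +
          (K * π * L / d * (d * π / 2 ^ J) ^ 2 + K * (d * π / N) +
            2 * ((J : ℝ) + 1) * Real.exp (-(hh : ℝ)) * (π ^ 4 * (K * d) * L / 8) *
              (1 + 2 * L * π / d * (d * π / 2 ^ J + d * π / N))) :=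
          add_le_add h1 h2
      _ ≤ 196000 * K * d * Real.logb 2 t ^ 2 / t := key

/-- ★★★ **EVERY LIPSCHITZ LINK OF EVERY ADDITIVE LIPSCHITZ STATISTIC AT THE RIDGE RATE UP TO `log²` — ALL BUDGETS**: for `1`-Lipschitz
`φ_i : [−1,1] → [0,1]`, `K`-Lipschitz `h` on `[0, d]` and every `t ≥ 2`, **`|h(Σ_iφ_i(x_i)) − P(x)| ≤ 2·10⁵·K·d·(log₂t)²∕t`** with `deg P ≤ t`
(module 160's theorem with one logarithm fewer; below `2^25` the constant `h(0)`). [folklore] -/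
theorem exists_mvPolynomial_near_lipschitzLink_additive_logSq {h : ℝ → ℝ} {K : ℝ} (hK0 : 0 ≤ K)
    (hK : ∀ s s', s ∈ Set.Icc (0 : ℝ) (Fintype.card ι) → s' ∈ Set.Icc (0 : ℝ) (Fintype.card ι) → |h s - h s'| ≤ K * |s - s'|)
    {t : ℕ} (ht : 2 ≤ t) :
    ∃ P : MvPolynomial ι ℝ, P.totalDegree ≤ t ∧
      ∀ x : ι → ℝ, (∀ i, x i ∈ Set.Icc (-1 : ℝ) 1) →
        |h (∑ i, φ i (x i)) - MvPolynomial.eval x P| ≤ 200000 * K * Fintype.card ι * Real.logb 2 t ^ 2 / t := by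
  set d : ℝ := (Fintype.card ι : ℝ) with hdd
  have hd : 0 < d := by rw [hdd]; exact_mod_cast Fintype.card_pos
  have ht0 : (0 : ℝ) < t := by exact_mod_cast (show 0 < t by omega)
  have hKd : 0 ≤ K * d := mul_nonneg hK0 hd.le
  have hΛ1 : 1 ≤ Real.logb 2 t := by
    rw [Real.le_logb_iff_rpow_le one_lt_two ht0, Real.rpow_one]; exact_mod_cast ht
  by_cases hbig : 2 ^ 25 ≤ t
  · obtain ⟨P, hP, herr⟩ := exists_mvPolynomial_near_lipschitzLink_additive_logSq_of_le hφL hφ0 hφ1 hK0 hK hbig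
    refine ⟨P, hP, fun x hx => (herr x hx).trans ?_⟩
    rw [← hdd]
    exact div_le_div_of_nonneg_right (by nlinarith only [hKd, pow_pos (by linarith only [hΛ1] : (0 : ℝ) < Real.logb 2 t) 2]) ht0.le
  · -- small budgets: the constant `h(0)`
    have hsmall : (t : ℝ) ≤ 200000 * Real.logb 2 t ^ 2 := by
      by_cases h4 : t ≤ 200000
      · have h1 : (t : ℝ) ≤ 200000 := by exact_mod_cast h4
        have h3 : (1 : ℝ) ≤ Real.logb 2 t ^ 2 := one_le_pow₀ hΛ1
        linarith only [h1, h3]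
      · have h17 : (17 : ℝ) ≤ Real.logb 2 t := by
          rw [Real.le_logb_iff_rpow_le one_lt_two ht0, show (17 : ℝ) = ((17 : ℕ) : ℝ) by norm_num, Real.rpow_natCast]
          norm_num
          exact_mod_cast (show 131072 ≤ t by omega)
        have h2 : (t : ℝ) ≤ 33554432 := by exact_mod_cast (show t ≤ 2 ^ 25 by omega)
        have h3 := pow_le_pow_left₀ (by norm_num) h17 2
        linarith only [h3, h2]
    refine ⟨MvPolynomial.C (h 0), by rw [MvPolynomial.totalDegree_C]; exact Nat.zero_le _, fun x hx => ?_⟩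
    have hS := additive_mem_Icc hφ0 hφ1 x hx
    rw [MvPolynomial.eval_C]
    calc |h (∑ i, φ i (x i)) - h 0| ≤ K * |(∑ i, φ i (x i)) - 0| := hK _ _ ⟨hS.1, hS.2⟩ ⟨le_rfl, Nat.cast_nonneg _⟩
      _ ≤ K * d := by
          refine mul_le_mul_of_nonneg_left ?_ hK0
          rw [sub_zero, abs_of_nonneg hS.1, hdd]; exact hS.2
      _ = K * d * 1 := (mul_one _).symm
      _ ≤ K * d * (200000 * Real.logb 2 t ^ 2 / t) := by
          refine mul_le_mul_of_nonneg_left ?_ hKd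
          rw [le_div_iff₀ ht0, one_mul]; exact hsmall
      _ = 200000 * K * Fintype.card ι * Real.logb 2 t ^ 2 / t := by rw [hdd]; ring


omit hφL hφ0 hφ1 in
/-- ★★★ **THE GENERAL COMPOSITION CLASS AT THE RIDGE RATE UP TO `log²`.**  For `K_φ`-Lipschitz, `G_φ`-bounded `φ_i` on `[−1,1]` (`K_φ, G_φ ≤ c`,
`0 < c`) and `h` with `|h(s) − h(s′)| ≤ K|s − s′|` on `[−dc, dc]` (`K ≥ 0`), every `t ≥ 2`: `P` of total degree `≤ t` with
`|h(Σ_iφ_i(x_i)) − P(x)| ≤ 2·10⁵·(2cK)·d·(log₂t)²∕t` on `[−1,1]^ι` (module 160's rescaling `ψ_i = (φ_i + c)∕2c`). [folklore] -/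
theorem exists_mvPolynomial_near_lipschitzLink_additive_general_logSq {φ : ι → ℝ → ℝ} {Kφ Gφ c : ℝ}
    (hφK : ∀ i, ∀ u v : ℝ, u ∈ Set.Icc (-1 : ℝ) 1 → v ∈ Set.Icc (-1 : ℝ) 1 → |φ i u - φ i v| ≤ Kφ * |u - v|)
    (hφG : ∀ i, ∀ u : ℝ, u ∈ Set.Icc (-1 : ℝ) 1 → |φ i u| ≤ Gφ) (hc : 0 < c) (hKc : Kφ ≤ c) (hGc : Gφ ≤ c)
    {h : ℝ → ℝ} {K : ℝ} (hK0 : 0 ≤ K)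
    (hK : ∀ s s', s ∈ Set.Icc (-(Fintype.card ι * c)) (Fintype.card ι * c) → s' ∈ Set.Icc (-(Fintype.card ι * c)) (Fintype.card ι * c) →
      |h s - h s'| ≤ K * |s - s'|)
    {t : ℕ} (ht : 2 ≤ t) :
    ∃ P : MvPolynomial ι ℝ, P.totalDegree ≤ t ∧
      ∀ x : ι → ℝ, (∀ i, x i ∈ Set.Icc (-1 : ℝ) 1) →
        |h (∑ i, φ i (x i)) - MvPolynomial.eval x P| ≤ 200000 * (2 * c * K) * Fintype.card ι * Real.logb 2 t ^ 2 / t := by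
  set d : ℝ := (Fintype.card ι : ℝ) with hdd
  have hd0 : 0 ≤ d := Nat.cast_nonneg _
  -- the rescaled inner functions
  set ψ : ι → ℝ → ℝ := fun i u => (φ i u + c) / (2 * c) with hψ
  have hψL : ∀ i, ∀ u v : ℝ, u ∈ Set.Icc (-1 : ℝ) 1 → v ∈ Set.Icc (-1 : ℝ) 1 → |ψ i u - ψ i v| ≤ 1 * |u - v| := by
    intro i u v hu hv
    rw [hψ]
    show |(φ i u + c) / (2 * c) - (φ i v + c) / (2 * c)| ≤ 1 * |u - v|
    rw [← sub_div, show φ i u + c - (φ i v + c) = φ i u - φ i v by ring, abs_div, abs_of_pos (by positivity : (0 : ℝ) < 2 * c),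
      div_le_iff₀ (by positivity : (0 : ℝ) < 2 * c)]
    have h1 := hφK i u v hu hv
    have h2 : Kφ * |u - v| ≤ c * |u - v| := mul_le_mul_of_nonneg_right hKc (abs_nonneg _)
    nlinarith [abs_nonneg (u - v)]
  have hψ0 : ∀ i, ∀ u : ℝ, u ∈ Set.Icc (-1 : ℝ) 1 → 0 ≤ ψ i u := by
    intro i u hu
    have := abs_le.1 ((hφG i u hu).trans hGc)
    rw [hψ]; show 0 ≤ (φ i u + c) / (2 * c); exact div_nonneg (by linarith) (by positivity)
  have hψ1 : ∀ i, ∀ u : ℝ, u ∈ Set.Icc (-1 : ℝ) 1 → ψ i u ≤ 1 := by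
    intro i u hu
    have := abs_le.1 ((hφG i u hu).trans hGc)
    rw [hψ]; show (φ i u + c) / (2 * c) ≤ 1; rw [div_le_one (by positivity)]; linarith
  -- the rescaled link
  set g : ℝ → ℝ := fun s => h (2 * c * s - d * c) with hg
  have hgK : ∀ s s', s ∈ Set.Icc (0 : ℝ) (Fintype.card ι) → s' ∈ Set.Icc (0 : ℝ) (Fintype.card ι) → |g s - g s'| ≤ 2 * c * K * |s - s'| := by
    intro s s' hs hs'
    rw [← hdd] at hs hs'
    have hmem : ∀ r : ℝ, r ∈ Set.Icc (0 : ℝ) d → 2 * c * r - d * c ∈ Set.Icc (-(Fintype.card ι * c)) (Fintype.card ι * c) := by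
      intro r hr
      rw [← hdd]
      constructor <;> nlinarith [hr.1, hr.2, hc]
    rw [hg]
    show |h (2 * c * s - d * c) - h (2 * c * s' - d * c)| ≤ 2 * c * K * |s - s'|
    calc |h (2 * c * s - d * c) - h (2 * c * s' - d * c)| ≤ K * |2 * c * s - d * c - (2 * c * s' - d * c)| :=
          hK _ _ (hmem s hs) (hmem s' hs')
      _ = 2 * c * K * |s - s'| := by
          rw [show 2 * c * s - d * c - (2 * c * s' - d * c) = 2 * c * (s - s') by ring, abs_mul,
            abs_of_pos (by positivity : (0 : ℝ) < 2 * c)]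
          ring
  obtain ⟨P, hP, herr⟩ := exists_mvPolynomial_near_lipschitzLink_additive_logSq hψL hψ0 hψ1 (by positivity : 0 ≤ 2 * c * K) hgK ht
  refine ⟨P, hP, fun x hx => ?_⟩
  have hid : g (∑ i, ψ i (x i)) = h (∑ i, φ i (x i)) := by
    rw [hg, hψ]
    show h (2 * c * (∑ i, (φ i (x i) + c) / (2 * c)) - d * c) = h (∑ i, φ i (x i))
    congr 1
    rw [← Finset.sum_div, Finset.sum_add_distrib, Finset.sum_const, card_univ, nsmul_eq_mul, hdd]
    field_simp
    ring
  rw [← hid]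
  exact (herr x hx).trans (le_of_eq (by ring))

end Summit.QuantumFields.YangMills.Theorems.BalabanUVNodesN19AdditiveLinksDegreeBudgetLogSq

end
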